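import Summits.ABC.IUTFork.Repair.CandMochizuki40TwoPlace
import Summits.ABC.IUTFork.Repair.CandJoshi9
import Summits.ABC.IUTFork.Repair.CandJoshi3
import HarnessLib

/-!
# IUT REPAIR branch (rung LADDER-ABC:A2.RP), rows RP-J01a/b/c + RP-J02a — the Joshi-shaped candidates on abc-iut-rp-m4's TWO-PLACE bed:
# Joshi's per-place dominance IS (LcGlIq)'s «placewise» shape, and with two places it is STRICTLY STRONGER than the typed Statement

PROOF-ONLY record file (D-0012; no definition, no `Prop` fact) of the abc-iut cell, IUT REPAIR branch (seat abc-iut-rp-j1; the item left OPEN in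
this seat's HANDOFF #2: «J01c on the two-place bed»). TAKES NO SIDE on [IUTchIII] Cor. 3.12 and on no author; typed ≠ proved; instantiated ≠ endorsed.
Candidates (reading predicates, never asserted): H_J1 `CandJoshi1.JoshiDominance`, H_J2 `CandJoshi1.JoshiVolumeDominance`, H_J2ᵖˡ
`CandJoshi9.JoshiPlaceDominance` (ATS III Thm. 7.3.1 read per place, label-summed), H_J3 `CandJoshi3.LocusCovers`; and abc-iut-rp-m4's typing of
S. Mochizuki's [Rpt2024-03] (LcGlIq)/(EssGlIq) p. 7–8: `CandMochizuki40.Placewise` («the local portion holds at every place»), `H := ¬Placewise`,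
`H' := Statement ∧ ¬Placewise` (RP-M40). Bed (cited BY NAME): rp-m4's `Cor312TwoPlaceSetting.twoSetting p c d` (p433752; two places `v = 0, 1`,
place-dependent log-shell inflation `d(v)`, weight `c`; Statement ⟺ `3 ≤ d 0 + d 1`, local portion at `v` ⟺ `3 ≤ 2·d(v)`) and its cells file
`Repair/CandMochizuki40TwoPlace` (p433915).

RESULTS (kernel, standard axioms):
* §1 **B3 ⟹ B1 on every setting**: `placewise_of_placeDominance : BridgeHyps P → JoshiPlaceDominance P → Placewise P` — Joshi's per-place
  dominance (the printed form of ATS III Thm. 7.3.1, «for each w … Hence by passage to the product») IMPLIES the placewise local inequality that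
  [Rpt2024-03] (EssGlIq) says «can never be obtained»; equivalently `H_of_rpt_excludes_placeDominance : CandMochizuki40.H P → ¬ JoshiPlaceDominance P`.
  The two disputed claims are thereby typed as CONTRADICTORY hypotheses on any one setting with the bridge hypotheses (neither asserted).
* §2 **on the two-place bed**: `two_placeDominance_iff : H_J2ᵖˡ ⟺ ∀ v, 3 ≤ 2·d(v)` (= rp-m4's `placewise_two_iff` set: `two_placeDominance_iff_placewise`)
  and `two_joshiVolumeDominance_iff : H_J2 ⟺ ∀ v, 3 ≤ d(v)`.
* §3 **at the profile of record `d = (0, 3)`** (`two_depth_cells`): the typed **Statement HOLDS** (compensation across places, rp-m4 `two_statement`)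
  while **H_J2ᵖˡ and H_J2 FAIL** (deep place `0`), and for EVERY pin-respecting region reading `(ρ, qK)` **H_J1 FAILS** and for every q-pinned reading
  **H_J3 FAILS** (they would license (xi-f), rp-m4 `two_not_licence`). So with two places every Joshi-shaped candidate is STRICTLY STRONGER than the
  Statement — the (LcGlIq)/(EssGlIq) separation that `CandJoshi9`'s docstring recorded as INEXPRESSIBLE on the one-place beds is now EXPRESSED.
* §4 at the even profile `d = (2, 2)` (`two_even_cells`): Statement ∧ H_J2ᵖˡ hold and H_J2 fails — per-place vs per-packet, on two places.
READING (neutral): in the frozen typing Joshi's per-place estimate and Mochizuki's (EssGlIq) are each consistent with the typed Corollary and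
inconsistent with each other; which describes the intended Θ-data is the dispute, untouched. [claim: Joshi2024ATSIII, status: disputed]
[claim: Mochizuki2012, status: disputed]
-/

noncomputable section

open Set

namespace Summit.ABC.IUTFork.Repair.CandJoshi9TwoPlace

open Thm311 Cor312 Cor312Vol Literature.IUT.LogThetaLattice
open Summit.ABC.IUTFork.Repair.CandJoshi1 Summit.ABC.IUTFork.Repair.CandJoshi3 Summit.ABC.IUTFork.Repair.CandJoshi9
open Summit.ABC.IUTFork.Repair.CandMochizuki40

/-! ## 1. Joshi's per-place dominance implies (LcGlIq)'s placewise inequality -/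

section General

variable {T : ThetaIndex} {S₀ : Situation T} (P₀ : Cor312.Setting S₀)

/-- **H_J2ᵖˡ ⟹ Placewise** (bridge hypotheses): at every place the label-averaged q-term is at most the label-averaged hull term
(`CandJoshi9.sum_qLocal_le_sum_thetaLocal`, divided by `l⋇`), and every hull term is finite (`ThetaFinite`). [claim: Joshi2024ATSIII, status: disputed] -/
theorem placewise_of_placeDominance (H : BridgeHyps P₀) (h : JoshiPlaceDominance P₀) : Placewise P₀ := fun vQ => by
  refine ⟨fun i => H.finite.1 i vQ, ?_⟩
  unfold localNegLogQ localNegLogTheta processionNormalized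
  exact div_le_div_of_nonneg_right (sum_qLocal_le_sum_thetaLocal P₀ H h vQ) (Nat.cast_nonneg _)

/-- **[Rpt2024-03]'s `H := ¬Placewise` EXCLUDES Joshi's H_J2ᵖˡ** on any setting with the bridge hypotheses (the two disputed claims typed as
contradictory hypotheses; neither asserted). [claim: Mochizuki2012, status: disputed] -/
theorem H_of_rpt_excludes_placeDominance (HB : BridgeHyps P₀) (hH : CandMochizuki40.H P₀) : ¬ JoshiPlaceDominance P₀ :=
  fun h => hH (placewise_of_placeDominance P₀ HB h)

/-- Hence the per-packet H_J2 is excluded too. [folklore] -/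
theorem H_of_rpt_excludes_volumeDominance (HB : BridgeHyps P₀) (hH : CandMochizuki40.H P₀) : ¬ JoshiVolumeDominance P₀ :=
  fun h => H_of_rpt_excludes_placeDominance P₀ HB hH (placeDominance_of_joshiVolumeDominance P₀ h)

end General

/-! ## 2. The Joshi candidates on the two-place bed -/

section Two

open Cor312Vol.TwoPlace Cor312Vol.NaiveProv Cor312Vol.PinnedWitness

variable (p : ℕ) [hp : Fact p.Prime] (c : ℝ) (d : twoIndex.VQ → ℕ)

/-- A label sum over `𝔽_l^⋇ = {1, 2}` is twice its procession-normalized value. [folklore] -/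
theorem sum_eq_two_mul_pn (f : Fin twoIndex.lstar → ℝ) : ∑ i, f i = 2 * processionNormalized f := by
  unfold processionNormalized
  show ∑ i, f i = 2 * ((∑ i, f i) / ((2 : ℕ) : ℝ))
  push_cast
  ring

/-- On the two-place bed the log-volume of the (unique) possible image at `(j, v)` is the hull term there. [folklore] -/
theorem two_logvol_possibleImage (i : Fin twoIndex.lstar) (vQ : twoIndex.VQ) {U : Set ((signShells twoIndex).Packet (Setting.labelSucc i) vQ)}
    (hU : U ∈ (twoSetting p c d).possibleImages (Setting.labelSucc i) vQ) :
    ((situationW p (fun _ => c) (thetaVec1 (T := twoIndex) p)).D (twoSetting p c d).n).logvol (Setting.labelSucc i) vQ U =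
      ((twoSetting p c d).thetaLocal (Setting.labelSucc i) vQ).untopD 0 := by
  rw [two_possibleImages, Set.mem_singleton_iff] at hU
  rw [hU, two_thetaLocal, WithTop.untopD_coe]
  show volW p (fun _ => c) _ vQ (pBall p _ vQ _) = _
  rw [volW_pBall]

/-- **H_J2ᵖˡ on the two-place bed ⟺ `3 ≤ 2·d(v)` at BOTH places** (for `c > 0`): the possible images are singletons, so H_J2ᵖˡ at `v` is
exactly the local portion at `v` (rp-m4's `two_local_iff`). [folklore] -/
theorem two_placeDominance_iff (hc : 0 < c) : JoshiPlaceDominance (twoSetting p c d) ↔ ∀ vQ : twoIndex.VQ, 3 ≤ 2 * d vQ := by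
  constructor
  · intro h vQ
    obtain ⟨U, hU, hle⟩ := h vQ
    rw [Finset.sum_congr rfl fun i _ => two_logvol_possibleImage p c d i vQ (hU i), sum_eq_two_mul_pn, sum_eq_two_mul_pn] at hle
    exact (two_local_iff p c d hc vQ).1 (by linarith)
  · intro hd vQ
    refine ⟨fun i => pBall p _ vQ (jsq (Setting.labelSucc i) - d vQ), fun i => by rw [two_possibleImages]; exact Set.mem_singleton _, ?_⟩
    have hmem : ∀ i : Fin twoIndex.lstar, pBall p (Setting.labelSucc i) vQ (jsq (Setting.labelSucc i) - d vQ) ∈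
        (twoSetting p c d).possibleImages (Setting.labelSucc i) vQ := fun i => by rw [two_possibleImages]; exact Set.mem_singleton _
    rw [Finset.sum_congr rfl fun i _ => two_logvol_possibleImage p c d i vQ (hmem i), sum_eq_two_mul_pn, sum_eq_two_mul_pn]
    have := (two_local_iff p c d hc vQ).2 (hd vQ)
    linarith

/-- On the two-place bed H_J2ᵖˡ and rp-m4's `Placewise` COINCIDE (both are `∀ v, 3 ≤ 2·d(v)`). [folklore] -/
theorem two_placeDominance_iff_placewise (hc : 0 < c) : JoshiPlaceDominance (twoSetting p c d) ↔ Placewise (twoSetting p c d) := by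
  rw [two_placeDominance_iff p c d hc, placewise_two_iff p c d hc]

/-- **H_J2 on the two-place bed ⟺ `3 ≤ d(v)` at BOTH places** (label `2`: `−c ≤ −(4 − d(v))·c`). [folklore] -/
theorem two_joshiVolumeDominance_iff (hc : 0 < c) : JoshiVolumeDominance (twoSetting p c d) ↔ ∀ vQ : twoIndex.VQ, 3 ≤ d vQ := by
  constructor
  · intro h vQ
    obtain ⟨U, hU, hle⟩ := h 1 vQ
    rw [two_logvol_possibleImage p c d 1 vQ hU, two_qLocal, two_thetaLocal, WithTop.untopD_coe, two_jsq.2] at hle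
    push_cast at hle
    have : (3 : ℝ) ≤ (d vQ : ℝ) := by nlinarith
    exact_mod_cast this
  · intro hd i vQ
    have hmem : pBall p (Setting.labelSucc i) vQ (jsq (Setting.labelSucc i) - d vQ) ∈ (twoSetting p c d).possibleImages (Setting.labelSucc i) vQ := by
      rw [two_possibleImages]; exact Set.mem_singleton _
    refine ⟨_, hmem, ?_⟩
    rw [two_logvol_possibleImage p c d i vQ hmem, two_qLocal, two_thetaLocal, WithTop.untopD_coe]
    have hj : (jsq (T := twoIndex) (Setting.labelSucc (T := twoIndex) i) : ℝ) ≤ 4 := by exact_mod_cast two_jsq_le i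
    have hd' : (3 : ℝ) ≤ (d vQ : ℝ) := by exact_mod_cast hd vQ
    push_cast
    nlinarith

/-! ## 3. The profile of record `d = (0, 3)`: the Statement holds, every Joshi-shaped candidate fails -/

/-- **H_J2ᵖˡ FAILS at `d = (0,3)`** (deep place `0`: `3 ≤ 0` is false) — while the Statement holds (`two_statement`). [folklore] -/
theorem two_depth_not_placeDominance (hc : 0 < c) : ¬ JoshiPlaceDominance (twoSetting p c depth) := fun h => by
  have := (two_placeDominance_iff p c depth hc).1 h 0
  rw [depth_val.1] at this
  exact absurd this (by decide)

/-- H_J2 FAILS at `d = (0,3)`. [folklore] -/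
theorem two_depth_not_volumeDominance (hc : 0 < c) : ¬ JoshiVolumeDominance (twoSetting p c depth) := fun h =>
  two_depth_not_placeDominance p c hc (placeDominance_of_joshiVolumeDominance _ h)

/-- For EVERY pin-respecting region reading `(ρ, qK)`, **H_J1 FAILS at `d = (0,3)`** (it would license (xi-f); rp-m4 `two_not_licence`). [folklore] -/
theorem two_depth_not_joshiDominance
    (ρ : (∀ v : twoIndex.V, v ∈ twoIndex.Vbad → Set ((signShells twoIndex).StarPacket v)) →
      ∀ (j : twoIndex.Label) (vQ : twoIndex.VQ), Set ((signShells twoIndex).Packet j vQ))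
    (qK : ∀ v : twoIndex.V, v ∈ twoIndex.Vbad → Set ((signShells twoIndex).StarPacket v))
    (hpin : PinnedRegions (twoFull p c).toLatticeSituation (twoSetting p c depth) ρ qK) :
    ¬ JoshiDominance (twoFull p c).toLatticeSituation (twoSetting p c depth) ρ qK := fun h =>
  two_not_licence p c (licence_of_joshiDominance _ _ _ _ hpin h)

/-- For EVERY q-pinned region reading, **H_J3 FAILS at `d = (0,3)`**. [folklore] -/
theorem two_depth_not_locusCovers
    (ρ : (∀ v : twoIndex.V, v ∈ twoIndex.Vbad → Set ((signShells twoIndex).StarPacket v)) →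
      ∀ (j : twoIndex.Label) (vQ : twoIndex.VQ), Set ((signShells twoIndex).Packet j vQ))
    (qK : ∀ v : twoIndex.V, v ∈ twoIndex.Vbad → Set ((signShells twoIndex).StarPacket v))
    (hq : QPinned (twoFull p c).toLatticeSituation (twoSetting p c depth) ρ qK) :
    ¬ LocusCovers (twoFull p c).toLatticeSituation (twoSetting p c depth) ρ qK := fun h =>
  two_not_licence p c (licence_of_pilotKummerCompatHull _ _ _ _ hq (hull_of_locusCovers _ _ _ _ h))

/-- **THE TWO-PLACE CELLS, packaged** (`c > 0`): typed Thm. 3.11 ∧ BridgeHyps ∧ `|log(q)| > 0` ∧ **Statement** ∧ ¬H_J2ᵖˡ ∧ ¬H_J2 ∧ (∀ pinned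
readings, ¬H_J1) ∧ (∀ q-pinned readings, ¬H_J3) ∧ rp-m4's `H'` — every Joshi-shaped candidate is STRICTLY STRONGER than the Statement at two places.
[claim: Joshi2024ATSIII, status: disputed] -/
theorem two_depth_cells (hc : 0 < c) :
    (twoFull p c).Statement ∧ BridgeHyps (twoSetting p c depth) ∧ (twoSetting p c depth).AbsLogQPos ∧
      Summit.ABC.IUTFork.Cor312.Setting.Statement (twoSetting p c depth) ∧
      ¬ JoshiPlaceDominance (twoSetting p c depth) ∧ ¬ JoshiVolumeDominance (twoSetting p c depth) ∧
      (∀ ρ qK, PinnedRegions (twoFull p c).toLatticeSituation (twoSetting p c depth) ρ qK →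
        ¬ JoshiDominance (twoFull p c).toLatticeSituation (twoSetting p c depth) ρ qK) ∧
      (∀ ρ qK, QPinned (twoFull p c).toLatticeSituation (twoSetting p c depth) ρ qK →
        ¬ LocusCovers (twoFull p c).toLatticeSituation (twoSetting p c depth) ρ qK) ∧
      CandMochizuki40.H' (twoSetting p c depth) :=
  ⟨twoFull_statement p c, two_bridgeHyps p c depth hc.le, two_absLogQPos p c depth hc, two_statement p c hc,
    two_depth_not_placeDominance p c hc, two_depth_not_volumeDominance p c hc, two_depth_not_joshiDominance p c,
    two_depth_not_locusCovers p c, H'_two p c hc⟩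

/-! ## 4. The even profile `d = (2, 2)`: per place yes, per packet no -/

/-- At `d ≡ 2`: the Statement and H_J2ᵖˡ HOLD, H_J2 FAILS — per-place vs per-packet separated on the two-place bed (as at LS(2) on one place).
[folklore] -/
theorem two_even_cells (hc : 0 < c) :
    Summit.ABC.IUTFork.Cor312.Setting.Statement (twoSetting p c fun _ => 2) ∧ JoshiPlaceDominance (twoSetting p c fun _ => 2) ∧
      ¬ JoshiVolumeDominance (twoSetting p c fun _ => 2) :=
  ⟨(two_statement_iff p c _ hc).2 (by norm_num), (two_placeDominance_iff p c _ hc).2 fun _ => by norm_num,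
    fun h => absurd ((two_joshiVolumeDominance_iff p c _ hc).1 h 0) (by norm_num)⟩

end Two

end Summit.ABC.IUTFork.Repair.CandJoshi9TwoPlace

end
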